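import Literature.AlgebraicGeometry.Resolution.PointBlowupIFPUnit
import Literature.AlgebraicGeometry.Resolution.PointBlowupMohBound
import Literature.AlgebraicGeometry.Resolution.OrdZeroBasics
import Mathlib.Algebra.BigOperators.Field
import HarnessLib

/-!
# Kawanoue–Matsuki 2016, Proposition 4 (2), in the purely inseparable corner of the point-blow-up atlas:
`μ̃` does not increase at a closed point of the exceptional divisor — PROVED in the tree's model

`Literature/AlgebraicGeometry/Resolution/PointBlowupIFPUnitProp4.lean` (cell `res-hironaka`, D-0124 rescue, literature
seat `res-rescue-harvest-1` g5; companion of `PointBlowupIFPUnit.lean`, cell `pub-rosobs` g15, whose definitions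
`PointBlowup.IFPState.step / muP / muPD / muTilde` it consumes unchanged).

**Source.** H. Kawanoue, K. Matsuki, *Resolution of singularities of an idealistic filtration in dimension 3 after
Benito–Villamayor*, Adv. Stud. Pure Math. **70** (2016) 115–214 = arXiv:1205.4556 (bib `KawanoueMatsuki2016`), §4.1
(the invariant `μ̃ = μ_P(ℛ) − Σ_{D ⊂ E_young} μ_{P,D}(ℛ)` of the transformation `ℛ` and the boundary `E_young`) and
**Proposition 4** («Proceeding in the vertical direction», arXiv chunk p0021 L27–43): «the value of the triplet
`(σ, μ̃, s)` does not increase … When `σ = σ̃`, the value of the invariant `μ̃` does not increase», with the printed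
proof of (2) (chunk p0023 L38–49): «by the same argument as the one used to show that the invariant `w-ord` does not
increase under transformation in the classical setting».

**What is proved here (the model statement, nothing more).** In the corner model of `PointBlowupIFPUnit.lean`
(hypersurface `x^q + F(y)`, carried family `J ↦ (∂_J F)~` at levels `q − |J|`, `E_young` = coordinate hyperplanes
through the point, transformation = `IFPState.step q j b`: chart `y_j` of the blow-up of the point, then translation
to the closed point `b` of the new exceptional divisor `{y_j = 0}`, i.e. `b j = 0`), for EVERY state whose point lies in
`Sing(ℛ)` (each non-zero carried generator has order at least its level — KM's standing hypothesis `C ⊂ Sing(ℛ)` for the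
centre `C = {P}`) and whose levels are positive:

* `IFPState.muTilde_step_le` : `(t.step q j b).muTilde q ≤ t.muTilde q` — Prop. 4 (2) for the closed-point centres of
  the model, in every dimension and every characteristic (the base field is any field);
* `IFPState.muTilde_step_init_le` : at a ROOT (`t = init q F`, `E_young = ∅`) the only hypothesis left is `q ≤ ord₀ F`
  (`init_sing`: a Hasse derivative lowers the order by at most its degree, `ordZero_sub_le_ordZero_hasseDeriv`);
* `IFPState.not_muTildeIncreases` : the census column `MuTildeIncreases` of `PointBlowupIFPUnit.lean` is identically
  false on such states; `IFPState.edgeRespectsProp4` : the edge predicate `EdgeRespectsProp4` holds (unconditionally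
  in its equimultiplicity / corner hypotheses).

The proof is the printed one made elementary: the order of the transported minimising generator at the new point is
bounded through the LAYER LEMMA `PointBlowup.exists_mem_support_translate_layer` of `PointBlowupMohBound.lean` (the
lowest `y_j`-layer of the chart transform is the initial form; lost boundary components `y_i`, `b_i ≠ 0`, are units at
the new point), while `μ_{P′,D_new} ≥ μ_P − 1` and `μ_{P′,D_i} ≥ μ_{P,D_i}` for the kept components are exponent
bookkeeping (`apply_eq_of_coeff_translate_monomial_ne_zero`). NOT covered (and not claimed): centres of positive
dimension, the change of `σ` (Prop. 4 (1)), the invariant `s` (Prop. 4 (3)), the horizontal direction (Prop. 3), the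
monomial case / termination (§5, Rem. 10). Every reading of the model as an instance of the printed statement is OURS
(see the header of `PointBlowupIFPUnit.lean`); nothing of Hironaka's 2017 manuscript is referred to or asserted.

## References
* H. Kawanoue, K. Matsuki, Adv. Stud. Pure Math. 70 (2016) 115–214 = arXiv:1205.4556, §4.1 and Proposition 4.
  [KawanoueMatsuki2016]
* H. Kawanoue, Publ. RIMS 43 (2007) 819–909, Rem. 3.2.2.2 (3) («`μ̃` is actually computed as `μ_{ℋ,E}`»). [Kawanoue2007]
-/

noncomputable section

open MvPolynomial Finset

open scoped BigOperators

namespace Literature.AlgebraicGeometry.Resolution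

open Literature.AlgebraicGeometry.Resolution.Hauser2010
open Literature.Barriers.ResolutionOfSingularities

namespace PointBlowup

variable {σ : Type*} {K : Type*} [Field K]

/-! ## 1. Small API: `levelRatio`, `divisorOrder`, `WithTop.untopD` -/

section API

/-- `levelRatio ⊤ a = ⊤`. [cite: KawanoueMatsuki2016, §4.1 (definition of μ_P)] -/
theorem levelRatio_top (a : ℕ) : levelRatio (⊤ : ℕ∞) a = ⊤ := rfl

/-- `levelRatio n a = n / a` for a finite order. [cite: KawanoueMatsuki2016, §4.1 (definition of μ_P)] -/
theorem levelRatio_natCast (n a : ℕ) : levelRatio (n : ℕ∞) a = (((n : ℚ) / a : ℚ) : WithTop ℚ) := rfl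

/-- `levelRatio` is monotone in the order. [cite: KawanoueMatsuki2016, §4.1 (definition of μ_P)] -/
theorem levelRatio_mono {n n' : ℕ∞} (h : n ≤ n') (a : ℕ) : levelRatio n a ≤ levelRatio n' a := by
  induction n' using ENat.recTopCoe with
  | top => exact le_top
  | coe m' =>
    induction n using ENat.recTopCoe with
    | top => exact absurd h (by simp)
    | coe m =>
      rw [levelRatio_natCast, levelRatio_natCast, WithTop.coe_le_coe]
      exact div_le_div_of_nonneg_right (by exact_mod_cast h) (Nat.cast_nonneg a)

/-- `levelRatio` is non-negative. [cite: KawanoueMatsuki2016, §4.1 (μ̃ is a nonnegative rational number)] -/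
theorem levelRatio_nonneg (n : ℕ∞) (a : ℕ) : (0 : WithTop ℚ) ≤ levelRatio n a := by
  induction n using ENat.recTopCoe with
  | top => exact le_top
  | coe m =>
    rw [levelRatio_natCast, ← WithTop.coe_zero, WithTop.coe_le_coe]
    exact div_nonneg (Nat.cast_nonneg m) (Nat.cast_nonneg a)

/-- The order along `{y_i = 0}` is at most the `y_i`-exponent of any monomial.
[cite: KawanoueMatsuki2016, §4.1 (definition of μ_{P,D})] -/
theorem divisorOrder_le_exponent {i : σ} {G : MvPolynomial σ K} {d : σ →₀ ℕ} (hd : d ∈ G.support) :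
    divisorOrder i G ≤ (d i : ℕ∞) :=
  Finset.inf_le hd

/-- A uniform lower bound on the `y_i`-exponents bounds the order along `{y_i = 0}` from below.
[cite: KawanoueMatsuki2016, §4.1 (definition of μ_{P,D})] -/
theorem le_divisorOrder_of_forall {i : σ} {G : MvPolynomial σ K} {n : ℕ} (h : ∀ d ∈ G.support, n ≤ d i) :
    (n : ℕ∞) ≤ divisorOrder i G :=
  Finset.le_inf fun d hd => by exact_mod_cast h d hd

/-- The order along a divisor of a non-zero polynomial is finite. [cite: KawanoueMatsuki2016, §4.1 (definition of μ_{P,D})] -/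
theorem divisorOrder_ne_top {i : σ} {G : MvPolynomial σ K} (hG : G ≠ 0) : divisorOrder i G ≠ ⊤ := by
  obtain ⟨d, hd⟩ := MvPolynomial.support_nonempty.mpr hG
  exact ne_top_of_le_ne_top (ENat.coe_ne_top (d i)) (divisorOrder_le_exponent hd)

/-- The toNat form of `divisorOrder_le_exponent`. [cite: KawanoueMatsuki2016, §4.1 (definition of μ_{P,D})] -/
theorem toNat_divisorOrder_le_exponent {i : σ} {G : MvPolynomial σ K} {d : σ →₀ ℕ} (hd : d ∈ G.support) :
    (divisorOrder i G).toNat ≤ d i := by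
  have h := divisorOrder_le_exponent (i := i) hd
  have hne : divisorOrder i G ≠ ⊤ := ne_top_of_le_ne_top (ENat.coe_ne_top (d i)) h
  rw [← ENat.coe_toNat hne] at h
  exact_mod_cast h

/-- `untopD 0 x ≤ r` when `x ≤ r`. [folklore] -/
private theorem untopD_le_of_le_coe {x : WithTop ℚ} {r : ℚ} (h : x ≤ (r : WithTop ℚ)) : x.untopD 0 ≤ r := by
  induction x using WithTop.recTopCoe with
  | top => exact absurd h (WithTop.not_top_le_coe r)
  | coe y => simpa using h

/-- `r ≤ untopD 0 x` when `r ≤ x ≠ ⊤`. [folklore] -/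
private theorem le_untopD_of_coe_le {x : WithTop ℚ} {r : ℚ} (h : (r : WithTop ℚ) ≤ x) (hx : x ≠ ⊤) :
    r ≤ x.untopD 0 := by
  induction x using WithTop.recTopCoe with
  | top => exact absurd rfl hx
  | coe y => simpa using h

/-- `untopD 0` is monotone below a finite bound. [folklore] -/
private theorem untopD_le_untopD {x y : WithTop ℚ} (h : x ≤ y) (hy : y ≠ ⊤) : x.untopD 0 ≤ y.untopD 0 := by
  induction y using WithTop.recTopCoe with
  | top => exact absurd rfl hy
  | coe z =>
    have h' := untopD_le_of_le_coe h
    simpa using h'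

/-- `untopD 0` of a non-negative element is non-negative. [folklore] -/
private theorem untopD_nonneg {x : WithTop ℚ} (h : (0 : WithTop ℚ) ≤ x) : 0 ≤ x.untopD 0 := by
  induction x using WithTop.recTopCoe with
  | top => simp
  | coe z => simpa using h

end API

/-! ## 2. Supports of the chart transform and of translations -/

section Supports

/-- Every monomial of the chart transform is the chart exponent of a monomial of `G`.
[cite: Hauser2010, §F (chart expressions of a point blowup)] -/
theorem exists_of_mem_support_chartTransform [DecidableEq σ] {a : ℕ} {j : σ} {G : MvPolynomial σ K} {e : σ →₀ ℕ}
    (he : e ∈ (chartTransform a j G).support) : ∃ d ∈ G.support, chartExponent a j d = e := by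
  unfold chartTransform at he
  obtain ⟨d, hd, -, h⟩ := exists_of_mem_support_sum_monomial _ _ _ he
  exact ⟨d, hd, h⟩

/-- When every monomial of `G` has degree `≥ a` (the point lies in `Sing`), the chart exponent of a monomial of `G`
is a monomial of the chart transform (no cancellation). [cite: Hauser2010, §F (chart expressions of a point blowup)] -/
theorem chartExponent_mem_support_chartTransform [Fintype σ] [DecidableEq σ] {a : ℕ} {j : σ} {G : MvPolynomial σ K} {d : σ →₀ ℕ}
    (hd : d ∈ G.support) (ha : ∀ d' ∈ G.support, a ≤ d'.degree) :
    chartExponent a j d ∈ (chartTransform a j G).support := by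
  rw [MvPolynomial.mem_support_iff]
  unfold chartTransform
  rw [coeff_sum_monomial_of_injOn G.support (chartExponent a j) (fun d => coeff d G) hd
    (fun x hx _ h => chartExponent_injective (ha x hx) (ha d hd) h)]
  exact MvPolynomial.mem_support_iff.mp hd

/-- At an untranslated variable (`b_i = 0`) a uniform lower bound on the `y_i`-exponents survives the translation.
[folklore] -/
private theorem le_apply_of_mem_support_translate [Fintype σ] [DecidableEq σ] (b : σ → K) {i : σ} (hbi : b i = 0) (P : MvPolynomial σ K)
    {β : σ →₀ ℕ} (hβ : β ∈ (translate b P).support) {n : ℕ} (hP : ∀ e ∈ P.support, n ≤ e i) : n ≤ β i := by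
  classical
  rw [MvPolynomial.mem_support_iff, translate_eq_sum_support, coeff_sum] at hβ
  obtain ⟨e, he, hne⟩ := Finset.exists_ne_zero_of_sum_ne_zero hβ
  rw [apply_eq_of_coeff_translate_monomial_ne_zero b hbi hne]
  exact hP e he

/-- All monomials of a non-zero `G` have degree at least `(ord₀ G).toNat`. [folklore] -/
private theorem toNat_ordZero_le_degree {G : MvPolynomial σ K} {d : σ →₀ ℕ} (hd : d ∈ G.support) :
    (ordZero G).toNat ≤ d.degree := by
  have h := ordZero_le_of_coeff_ne_zero G d (MvPolynomial.mem_support_iff.mp hd)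
  have hne : ordZero G ≠ ⊤ := ne_top_of_le_ne_top (ENat.coe_ne_top _) h
  rw [← ENat.coe_toNat hne] at h
  exact_mod_cast h

/-- **New exceptional component.** Every monomial of the transported generator
`translate b (chartTransform a j G)` (`b_j = 0`) has `y_j`-exponent at least `ord₀ G − a`.
[cite: KawanoueMatsuki2016, Proposition 4 (2) (proof, transformation `c_{f,𝕆}/x_j^a`)] -/
theorem le_divisorOrder_new [Fintype σ] [DecidableEq σ] (b : σ → K) {j : σ} (hbj : b j = 0) (a : ℕ) (G : MvPolynomial σ K) :
    (((ordZero G).toNat - a : ℕ) : ℕ∞) ≤ divisorOrder j (translate b (chartTransform a j G)) := by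
  refine le_divisorOrder_of_forall fun β hβ => ?_
  refine le_apply_of_mem_support_translate b hbj _ hβ fun e he => ?_
  obtain ⟨d, hd, rfl⟩ := exists_of_mem_support_chartTransform he
  rw [chartExponent_apply, if_pos rfl]
  exact Nat.sub_le_sub_right (toNat_ordZero_le_degree hd) a

/-- **Kept components.** For a kept boundary component `{y_i = 0}` (`i ≠ j`, `b_i = 0`) the order along it does not
drop under the transformation. [cite: KawanoueMatsuki2016, Proposition 4 (2) (proof)] -/
theorem divisorOrder_le_divisorOrder_kept [Fintype σ] [DecidableEq σ] (b : σ → K) {i j : σ} (hij : i ≠ j) (hbi : b i = 0) (a : ℕ)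
    (G : MvPolynomial σ K) :
    divisorOrder i G ≤ divisorOrder i (translate b (chartTransform a j G)) := by
  by_cases hG : G = 0
  · subst hG
    simp [chartTransform, translate, divisorOrder]
  rw [← ENat.coe_toNat (divisorOrder_ne_top (i := i) hG)]
  refine le_divisorOrder_of_forall fun β hβ => ?_
  refine le_apply_of_mem_support_translate b hbi _ hβ fun e he => ?_
  obtain ⟨d, hd, rfl⟩ := exists_of_mem_support_chartTransform he
  rw [chartExponent_apply, if_neg hij]
  exact toNat_divisorOrder_le_exponent hd

/-- **The order bound at the new point.** If `G` has finite order `d ≥ a` at the origin (so `G ≠ 0`), `b_j = 0`, and `L` is a set of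
LOST components (`i ≠ j`, `b_i ≠ 0`), then the transported generator has a monomial of degree
`≤ 2d − a − ε_j − Σ_{i ∈ L} ε_i` (`ε_i` = order of `G` along `{y_i = 0}`): the lowest `y_j`-layer of the chart transform
is the initial form of `G`, and the lost factors `(y_i + b_i)^{ε_i}` are units at the new point — the layer lemma of
`PointBlowupMohBound.lean`. [cite: KawanoueMatsuki2016, Proposition 4 (2) (proof: «the same argument as … w-ord does not increase»)] -/
theorem exists_mem_support_step_degree_le [Fintype σ] [DecidableEq σ] [DecidableEq K] (b : σ → K) {j : σ} (hbj : b j = 0) {G : MvPolynomial σ K}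
    {a d : ℕ} (hd : ordZero G = d) (had : a ≤ d) (L : Finset σ) (hLj : j ∉ L)
    (hLb : ∀ i ∈ L, b i ≠ 0) :
    ∃ E ∈ (translate b (chartTransform a j G)).support,
      E.degree + (divisorOrder j G).toNat + (∑ i ∈ L, (divisorOrder i G).toNat) + a ≤ 2 * d := by
  classical
  -- the exponents of `G`: degrees `≥ d`, one of degree `d`, divisibility by `y_i^{ε_i}`
  set ε : σ → ℕ := fun i => (divisorOrder i G).toNat with hε
  have hdeg : ∀ d' ∈ G.support, d ≤ d'.degree := fun d' hd' => by
    have := toNat_ordZero_le_degree hd'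
    rwa [hd, ENat.toNat_coe] at this
  obtain ⟨⟨dstar, hdstar, hdstardeg⟩, -⟩ := (ordZero_eq_nat_iff G d).mp hd
  have hdstar' : dstar ∈ G.support := MvPolynomial.mem_support_iff.mpr hdstar
  have hεle : ∀ d' ∈ G.support, ∀ i, ε i ≤ d' i := fun d' hd' i => toNat_divisorOrder_le_exponent hd'
  -- ε_j + Σ_L ε_i ≤ d (read off the degree-d monomial)
  have hS : ε j + ∑ i ∈ L, ε i ≤ d := by
    have h1 : ε j + ∑ i ∈ L, ε i ≤ dstar j + ∑ i ∈ L, dstar i :=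
      add_le_add (hεle dstar hdstar' j) (Finset.sum_le_sum fun i _ => hεle dstar hdstar' i)
    have h2 : dstar j + ∑ i ∈ L, dstar i = ∑ i ∈ insert j L, dstar i := (Finset.sum_insert hLj).symm
    have h3 : ∑ i ∈ insert j L, dstar i ≤ ∑ i, dstar i :=
      Finset.sum_le_sum_of_subset_of_nonneg (Finset.subset_univ _) fun _ _ _ => Nat.zero_le _
    have h4 : ∑ i, dstar i = dstar.degree := (Finsupp.degree_eq_sum dstar).symm
    omega
  -- the divisor ρ = y_j^{d−a} ∏_{i∈L} y_i^{ε_i}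
  set ρ : σ →₀ ℕ := Finsupp.single j (d - a) + ∑ i ∈ L, Finsupp.single i (ε i) with hρ
  have hρapply : ∀ k, ρ k = (if j = k then d - a else 0) + (if k ∈ L then ε k else 0) := by
    intro k
    rw [hρ, Finsupp.add_apply, Finsupp.single_apply, Finsupp.finsetSum_apply]
    congr 1
    rw [Finset.sum_congr rfl fun i _ => (Finsupp.single_apply : (Finsupp.single i (ε i)) k = _)]
    exact Finset.sum_ite_eq' L k ε
  have hρj : ρ j = d - a := by
    rw [hρapply, if_pos rfl, if_neg hLj, add_zero]
  have hρL : ∀ i ∈ L, ρ i = ε i := by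
    intro i hi
    have hij : j ≠ i := fun h => hLj (h ▸ hi)
    rw [hρapply, if_neg hij, if_pos hi, zero_add]
  have hρ0 : ∀ k, k ≠ j → k ∉ L → ρ k = 0 := by
    intro k hkj hkL
    rw [hρapply, if_neg (Ne.symm hkj), if_neg hkL]
  have hρdeg : ρ.degree = (d - a) + ∑ i ∈ L, ε i := by
    rw [hρ, map_add, map_sum, Finsupp.degree_single]
    congr 1
    exact Finset.sum_congr rfl fun i _ => Finsupp.degree_single _ _
  have hρfilt : (ρ.filter fun i => b i = 0).degree = d - a := by
    have : (ρ.filter fun i => b i = 0) = Finsupp.single j (d - a) := by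
      ext k
      rw [Finsupp.filter_apply]
      by_cases hkj : k = j
      · subst hkj; rw [if_pos hbj, hρj, Finsupp.single_eq_same]
      · rw [Finsupp.single_apply, if_neg (Ne.symm hkj)]
        by_cases hkL : k ∈ L
        · rw [if_neg (hLb k hkL)]
        · rw [hρ0 k hkj hkL, ite_self]
    rw [this, Finsupp.degree_single]
  -- hypotheses of the layer lemma for P = chartTransform a j G
  set P := chartTransform a j G with hP
  have hsuppP : ∀ e ∈ P.support, ∃ d' ∈ G.support, chartExponent a j d' = e :=
    fun e he => exists_of_mem_support_chartTransform he
  have hρle : ∀ e ∈ P.support, ρ ≤ e := by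
    intro e he
    obtain ⟨d', hd', rfl⟩ := hsuppP e he
    rw [Finsupp.le_def]
    intro k
    by_cases hkj : k = j
    · subst hkj
      rw [hρj, chartExponent_apply, if_pos rfl]
      exact Nat.sub_le_sub_right (hdeg d' hd') a
    · rw [chartExponent_apply, if_neg hkj]
      by_cases hkL : k ∈ L
      · rw [hρL k hkL]; exact hεle d' hd' k
      · rw [hρ0 k hkj hkL]; exact Nat.zero_le _
  set D : ℕ := d - ε j - ∑ i ∈ L, ε i with hD
  have hDbound : ∀ e ∈ P.support, e j = ρ j → e.degree ≤ ρ.degree + D := by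
    intro e he hej
    obtain ⟨d', hd', rfl⟩ := hsuppP e he
    rw [chartExponent_apply, if_pos rfl, hρj] at hej
    have h1 : d'.degree = d := by have := hdeg d' hd'; omega
    rw [degree_chartExponent, hρdeg, hD, h1]
    have h2 := hεle d' hd' j
    omega
  have hlayer : ∃ e ∈ P.support, e j = ρ j :=
    ⟨chartExponent a j dstar, chartExponent_mem_support_chartTransform hdstar' fun d' hd' => had.trans (hdeg d' hd'),
      by rw [chartExponent_apply, if_pos rfl, hρj, hdstardeg]⟩
  obtain ⟨E, hE, -, hEdeg⟩ := exists_mem_support_translate_layer b hbj P ρ hρle D hDbound hlayer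
  refine ⟨E, hE, ?_⟩
  rw [hρfilt, hD] at hEdeg
  simp only [hε] at hS hEdeg ⊢
  omega

end Supports

/-! ## 3. Proposition 4 (2) in the corner model -/

namespace IFPState

/-- `μ_P` is attained at a carried index (or is `⊤`). [cite: KawanoueMatsuki2016, §4.1 (definition of μ_P)] -/
theorem exists_muP_eq (q : ℕ) (t : IFPState σ K) (h : t.muP q ≠ ⊤) :
    ∃ J ∈ t.idx, t.muP q = levelRatio (ordZero (t.gen J)) (q - J.degree) := by
  have hne : t.idx.Nonempty := by
    rw [Finset.nonempty_iff_ne_empty]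
    intro he
    exact h (muP_of_idx_empty q t he)
  obtain ⟨J, hJ, hJeq⟩ := Finset.exists_mem_eq_inf t.idx hne (fun J => levelRatio (ordZero (t.gen J)) (q - J.degree))
  exact ⟨J, hJ, hJeq⟩

/-- `μ_{P,D_i} ≥ 0`. [cite: KawanoueMatsuki2016, §4.1 (μ̃ is a nonnegative rational number)] -/
theorem muPD_nonneg (q : ℕ) (t : IFPState σ K) (i : σ) : (0 : WithTop ℚ) ≤ t.muPD q i :=
  Finset.le_inf fun _ _ => levelRatio_nonneg _ _

/-- **Kawanoue–Matsuki 2016, Prop. 4 (2), corner model, closed-point centres.** For a corner state `t` of the IFP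
first unit whose point lies in `Sing(ℛ)` (every non-zero carried generator `(∂_J F)~` has order at least its level
`q − |J|`) and whose levels are positive, and for every chart `y_j` and every closed point `b` of the new exceptional
divisor (`b_j = 0`), the transported unit does not increase: `μ̃(t.step q j b) ≤ μ̃(t)`.
[cite: KawanoueMatsuki2016, Proposition 4 (2)] -/
theorem muTilde_step_le [Fintype σ] [DecidableEq σ] [DecidableEq K] (q : ℕ) (j : σ) (b : σ → K) (hbj : b j = 0) (t : IFPState σ K)
    (hlev : ∀ J ∈ t.idx, J.degree < q)
    (hsing : ∀ J ∈ t.idx, t.gen J ≠ 0 → (((q - J.degree : ℕ) : ℕ∞)) ≤ ordZero (t.gen J)) :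
    (t.step q j b).muTilde q ≤ t.muTilde q := by
  classical
  -- Case μ_P = ⊤ : nothing to prove
  by_cases htop : t.muP q = ⊤
  · have : t.muTilde q = ⊤ := by unfold muTilde; rw [htop]; rfl
    rw [this]; exact le_top
  -- the minimising index J₀, its generator g₀ ≠ 0, level a₀ > 0, order d₀ ≥ a₀
  obtain ⟨J₀, hJ₀, hμ⟩ := exists_muP_eq q t htop
  set g₀ := t.gen J₀ with hg₀
  set a₀ : ℕ := q - J₀.degree with ha₀
  have hg₀ne : g₀ ≠ 0 := by
    intro h0
    apply htop
    rw [hμ, h0, ordZero_zero]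
    rfl
  have ha₀pos : 0 < a₀ := by have := hlev J₀ hJ₀; omega
  obtain ⟨d₀, hd₀⟩ := exists_ordZero_eq_natCast hg₀ne
  have had₀ : a₀ ≤ d₀ := by
    have := hsing J₀ hJ₀ hg₀ne
    rw [← hg₀, hd₀] at this
    exact_mod_cast this
  have ha₀q : (0 : ℚ) < a₀ := by exact_mod_cast ha₀pos
  -- μ_P = d₀ / a₀
  have hμval : t.muP q = (((d₀ : ℚ) / a₀ : ℚ) : WithTop ℚ) := by
    rw [hμ, hd₀]; rfl
  set m : ℚ := (d₀ : ℚ) / a₀ with hm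
  -- every carried J: d_J / a_J ≥ m
  have hratio : ∀ J ∈ t.idx, (m : WithTop ℚ) ≤ levelRatio (ordZero (t.gen J)) (q - J.degree) := by
    intro J hJ
    rw [← hμval]
    exact Finset.inf_le hJ
  -- the transported state
  set t' := t.step q j b with ht'
  have hgen' : ∀ J, t'.gen J = translate b (chartTransform (q - J.degree) j (t.gen J)) := fun J => rfl
  have hidx' : t'.idx = t.idx := rfl
  have hyoung' : t'.young = insert j (t.young.filter fun i => b i = 0) := rfl
  -- lost components and the order bound for g₀ at the new point
  set Lost : Finset σ := (t.young.erase j).filter fun i => b i ≠ 0 with hLost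
  set Kept : Finset σ := (t.young.erase j).filter fun i => b i = 0 with hKept
  have hLostj : j ∉ Lost := by simp [hLost]
  have hLostb : ∀ i ∈ Lost, b i ≠ 0 := fun i hi => (Finset.mem_filter.mp hi).2
  obtain ⟨E, hE, hEdeg⟩ :=
    exists_mem_support_step_degree_le b hbj hd₀ had₀ Lost hLostj hLostb
  set ε : σ → ℕ := fun i => (divisorOrder i g₀).toNat with hε
  -- (1) μ_P' ≤ |E| / a₀
  have hg₀' : t'.gen J₀ = translate b (chartTransform a₀ j g₀) := hgen' J₀
  have hg₀'ne : t'.gen J₀ ≠ 0 := by rw [hg₀']; exact MvPolynomial.ne_zero_iff.mpr ⟨E, MvPolynomial.mem_support_iff.mp hE⟩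
  have hμ'le : t'.muP q ≤ (((E.degree : ℚ) / a₀ : ℚ) : WithTop ℚ) := by
    calc t'.muP q ≤ levelRatio (ordZero (t'.gen J₀)) (q - J₀.degree) := Finset.inf_le (hidx' ▸ hJ₀)
      _ ≤ levelRatio (E.degree : ℕ∞) a₀ := by
          rw [hg₀']
          exact levelRatio_mono (ordZero_le_of_coeff_ne_zero _ E (MvPolynomial.mem_support_iff.mp hE)) a₀
      _ = _ := levelRatio_natCast _ _
  have hμ'ne : t'.muP q ≠ ⊤ := ne_top_of_le_ne_top WithTop.coe_ne_top hμ'le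
  obtain ⟨m', hm'⟩ := WithTop.ne_top_iff_exists.mp hμ'ne
  have hm'le : m' ≤ (E.degree : ℚ) / a₀ := by
    have := hμ'le; rw [← hm'] at this; exact WithTop.coe_le_coe.mp this
  -- (2) μ_{P',D_j} ≥ m − 1
  have hnew : ((m - 1 : ℚ) : WithTop ℚ) ≤ t'.muPD q j := by
    refine Finset.le_inf fun J hJ => ?_
    rw [hidx'] at hJ
    rw [hgen']
    by_cases hJ0 : t.gen J = 0
    · rw [hJ0]; simp [chartTransform, translate, divisorOrder, levelRatio_top]
    obtain ⟨dJ, hdJ⟩ := exists_ordZero_eq_natCast hJ0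
    have haJ : q - J.degree ≤ dJ := by
      have := hsing J hJ hJ0; rw [hdJ] at this; exact_mod_cast this
    have haJpos : (0 : ℚ) < (q - J.degree : ℕ) := by have := hlev J hJ; exact_mod_cast (by omega : 0 < q - J.degree)
    have h1 := le_divisorOrder_new b hbj (q - J.degree) (t.gen J)
    rw [hdJ, ENat.toNat_coe] at h1
    calc ((m - 1 : ℚ) : WithTop ℚ) ≤ ((((dJ - (q - J.degree) : ℕ) : ℚ) / (q - J.degree : ℕ) : ℚ) : WithTop ℚ) := by
          rw [WithTop.coe_le_coe]
          have hr := hratio J hJ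
          rw [hdJ, levelRatio_natCast, WithTop.coe_le_coe] at hr
          rw [Nat.cast_sub haJ, sub_div, div_self (ne_of_gt haJpos)]
          linarith
      _ = levelRatio ((dJ - (q - J.degree) : ℕ) : ℕ∞) (q - J.degree) := (levelRatio_natCast _ _).symm
      _ ≤ levelRatio (divisorOrder j (translate b (chartTransform (q - J.degree) j (t.gen J)))) (q - J.degree) :=
          levelRatio_mono h1 _
  -- (3) kept components: μ_{P',D_i} ≥ μ_{P,D_i}
  have hkept : ∀ i ∈ Kept, t.muPD q i ≤ t'.muPD q i := by
    intro i hi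
    have hij : i ≠ j := Finset.ne_of_mem_erase (Finset.mem_filter.mp hi).1
    have hbi : b i = 0 := (Finset.mem_filter.mp hi).2
    refine Finset.le_inf fun J hJ => ?_
    rw [hidx'] at hJ
    rw [hgen']
    calc t.muPD q i ≤ levelRatio (divisorOrder i (t.gen J)) (q - J.degree) := Finset.inf_le hJ
      _ ≤ _ := levelRatio_mono (divisorOrder_le_divisorOrder_kept b hij hbi _ _) _
  -- finiteness of the μ_{P,D}'s involved (bounded by the J₀ term)
  have hPDfin : ∀ i, t.muPD q i ≤ (((ε i : ℚ) / a₀ : ℚ) : WithTop ℚ) := by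
    intro i
    calc t.muPD q i ≤ levelRatio (divisorOrder i g₀) (q - J₀.degree) := Finset.inf_le hJ₀
      _ = _ := by rw [← ENat.coe_toNat (divisorOrder_ne_top (i := i) hg₀ne)]; exact levelRatio_natCast _ _
  have hPD'fin : ∀ i, t'.muPD q i ≠ ⊤ := by
    intro i
    have h1 : t'.muPD q i ≤ levelRatio (divisorOrder i (t'.gen J₀)) (q - J₀.degree) := Finset.inf_le (hidx' ▸ hJ₀)
    rw [← ENat.coe_toNat (divisorOrder_ne_top (i := i) hg₀'ne), levelRatio_natCast] at h1
    exact ne_top_of_le_ne_top WithTop.coe_ne_top h1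
  -- the untopD'd numbers
  set u : σ → ℚ := fun i => (t.muPD q i).untopD 0 with hu
  set u' : σ → ℚ := fun i => (t'.muPD q i).untopD 0 with hu'
  have hu_nonneg : ∀ i, 0 ≤ u i := fun i => untopD_nonneg (muPD_nonneg q t i)
  have hu'_nonneg : ∀ i, 0 ≤ u' i := fun i => untopD_nonneg (muPD_nonneg q t' i)
  have hu_le : ∀ i, u i ≤ (ε i : ℚ) / a₀ := fun i => untopD_le_of_le_coe (hPDfin i)
  have hu'j : m - 1 ≤ u' j := le_untopD_of_coe_le hnew (hPD'fin j)
  have hu'kept : ∀ i ∈ Kept, u i ≤ u' i := fun i hi => untopD_le_untopD (hkept i hi) (hPD'fin i)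
  -- unfold the two μ̃'s
  have hμt : t.muTilde q = ((m - ∑ i ∈ t.young, u i : ℚ) : WithTop ℚ) := by
    unfold muTilde; rw [hμval]; rfl
  have hμt' : t'.muTilde q = ((m' - ∑ i ∈ t'.young, u' i : ℚ) : WithTop ℚ) := by
    unfold muTilde; rw [← hm']; rfl
  rw [hμt, hμt', WithTop.coe_le_coe]
  -- sums over young' and young
  have hsum' : u' j + ∑ i ∈ Kept, u' i ≤ ∑ i ∈ t'.young, u' i := by
    have hj : j ∈ t'.young := mem_young_step q j b t
    rw [← Finset.add_sum_erase _ _ hj, hyoung', Finset.erase_insert_eq_erase, hKept]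
    have : (t.young.erase j).filter (fun i => b i = 0) = (t.young.filter fun i => b i = 0).erase j := by
      ext i; simp [Finset.mem_filter, Finset.mem_erase, and_assoc]
    rw [this]
  have hsum : ∑ i ∈ t.young, u i ≤ (ε j : ℚ) / a₀ + ∑ i ∈ Kept, u i + ∑ i ∈ Lost, (ε i : ℚ) / a₀ := by
    have hsplit : ∑ i ∈ t.young.erase j, u i = ∑ i ∈ Kept, u i + ∑ i ∈ Lost, u i := by
      rw [hKept, hLost]
      exact (Finset.sum_filter_add_sum_filter_not (t.young.erase j) (fun i => b i = 0) u).symm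
    have hLostle : ∑ i ∈ Lost, u i ≤ ∑ i ∈ Lost, (ε i : ℚ) / a₀ := Finset.sum_le_sum fun i _ => hu_le i
    by_cases hjY : j ∈ t.young
    · rw [← Finset.add_sum_erase _ _ hjY, hsplit]
      have := hu_le j
      linarith
    · rw [← Finset.erase_eq_of_notMem hjY, hsplit]
      have : (0 : ℚ) ≤ (ε j : ℚ) / a₀ := div_nonneg (Nat.cast_nonneg _) (Nat.cast_nonneg _)
      linarith
  -- the order bound in ℚ
  have hEq : (E.degree : ℚ) + ε j + (∑ i ∈ Lost, (ε i : ℚ)) + a₀ ≤ 2 * d₀ := by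
    have := hEdeg
    simp only [hε] at this ⊢
    exact_mod_cast this
  have hsumdiv : ∑ i ∈ Lost, (ε i : ℚ) / a₀ = (∑ i ∈ Lost, (ε i : ℚ)) / a₀ := by
    rw [Finset.sum_div]
  have hkey : (E.degree : ℚ) / a₀ + (ε j : ℚ) / a₀ + (∑ i ∈ Lost, (ε i : ℚ)) / a₀ + 1 ≤ 2 * m := by
    have h1 : ((E.degree : ℚ) + ε j + (∑ i ∈ Lost, (ε i : ℚ)) + a₀) / a₀ ≤ (2 * d₀ : ℚ) / a₀ :=
      div_le_div_of_nonneg_right hEq (le_of_lt ha₀q)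
    have h2 : ((E.degree : ℚ) + ε j + (∑ i ∈ Lost, (ε i : ℚ)) + a₀) / a₀
        = (E.degree : ℚ) / a₀ + (ε j : ℚ) / a₀ + (∑ i ∈ Lost, (ε i : ℚ)) / a₀ + 1 := by
      rw [add_div, add_div, add_div, div_self (ne_of_gt ha₀q)]
    have h3 : (2 * d₀ : ℚ) / a₀ = 2 * m := by rw [hm, mul_div_assoc]
    linarith [h1, h2, h3]
  have hKsum : ∑ i ∈ Kept, u i ≤ ∑ i ∈ Kept, u' i := Finset.sum_le_sum fun i hi => hu'kept i hi
  rw [hsumdiv] at hsum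
  linarith [hsum', hsum, hKsum, hu'j, hm'le, hkey]

/-- The census column `MuTildeIncreases` is empty on singular corner states with positive levels.
[cite: KawanoueMatsuki2016, Proposition 4 (2)] -/
theorem not_muTildeIncreases [Fintype σ] [DecidableEq σ] [DecidableEq K] (q : ℕ) (j : σ) (b : σ → K) (hbj : b j = 0) (t : IFPState σ K)
    (hlev : ∀ J ∈ t.idx, J.degree < q)
    (hsing : ∀ J ∈ t.idx, t.gen J ≠ 0 → (((q - J.degree : ℕ) : ℕ∞)) ≤ ordZero (t.gen J)) :
    ¬ MuTildeIncreases q j b t :=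
  not_lt.mpr (muTilde_step_le q j b hbj t hlev hsing)

/-- The edge predicate `EdgeRespectsProp4` holds for such states (its equimultiplicity and corner hypotheses are not
even needed). [cite: KawanoueMatsuki2016, Proposition 4 (2)] -/
theorem edgeRespectsProp4 [Fintype σ] [DecidableEq σ] [DecidableEq K] (q : ℕ) (j : σ) (b : σ → K) (hbj : b j = 0) (s : State σ K) (t : IFPState σ K)
    (hlev : ∀ J ∈ t.idx, J.degree < q)
    (hsing : ∀ J ∈ t.idx, t.gen J ≠ 0 → (((q - J.degree : ℕ) : ℕ∞)) ≤ ordZero (t.gen J)) :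
    EdgeRespectsProp4 q j b s t :=
  fun _ _ _ => muTilde_step_le q j b hbj t hlev hsing

end IFPState

/-! ## 4. The root of the atlas: one step from `init q F` needs only `q ≤ ord₀ F` -/

/-- The degree of a truncated difference: `|d| ≤ |d − J| + |J|`. [folklore] -/
private theorem degree_le_degree_tsub_add_degree [Fintype σ] (d J : σ →₀ ℕ) :
    d.degree ≤ (d - J).degree + J.degree := by
  rw [← map_add]
  exact degree_le_degree_of_le (Finsupp.le_def.mpr fun i => by
    rw [Finsupp.add_apply, Finsupp.tsub_apply]; omega)

/-- A Hasse derivative lowers the order at the origin by at most its degree: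
`ord₀ F − |J| ≤ ord₀ (∂_J F)`. [cite: Kawanoue2007, Lemma 1.2.1.2 (1)(i)] -/
theorem ordZero_sub_le_ordZero_hasseDeriv [Fintype σ] [DecidableEq σ] (J : σ →₀ ℕ) (F : MvPolynomial σ K) :
    ordZero F - (J.degree : ℕ∞) ≤ ordZero (hasseDeriv J F) := by
  classical
  by_cases hF : F = 0
  · subst hF; simp [hasseDeriv]
  obtain ⟨o, ho⟩ := exists_ordZero_eq_natCast hF
  rw [ho, ← ENat.coe_sub]
  refine le_ordZero_of_forall _ _ fun e he => ?_
  unfold hasseDeriv at he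
  obtain ⟨d, hd, -, hde⟩ := exists_of_mem_support_sum_monomial _ _ _ (MvPolynomial.mem_support_iff.mpr he)
  have h1 : o ≤ d.degree := by
    have := toNat_ordZero_le_degree hd
    rwa [ho, ENat.toNat_coe] at this
  have h2 := degree_le_degree_tsub_add_degree d J
  rw [hde] at h2
  omega

namespace IFPState

/-- At a root of the atlas with `q ≤ ord₀ F` (a point of multiplicity `q` of `x^q + F`), the year-0 state `init q F`
lies in `Sing(ℛ₀)`: every carried derivative `∂_J F` has order at least its level `q − |J|`.
[cite: Kawanoue2007, Lemma 2.2.1.2 (𝔇-saturation generated by the Hasse derivatives)] -/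
theorem init_sing [Fintype σ] [DecidableEq σ] [DecidableEq K] (q : ℕ) {F : MvPolynomial σ K}
    (hF : (q : ℕ∞) ≤ ordZero F) :
    ∀ J ∈ (init q F).idx, (init q F).gen J ≠ 0 → (((q - J.degree : ℕ) : ℕ∞)) ≤ ordZero ((init q F).gen J) := by
  intro J _ _
  show (((q - J.degree : ℕ) : ℕ∞)) ≤ ordZero (hasseDeriv J F)
  calc (((q - J.degree : ℕ) : ℕ∞)) = (q : ℕ∞) - (J.degree : ℕ∞) := (ENat.coe_sub _ _)
    _ ≤ ordZero F - (J.degree : ℕ∞) := tsub_le_tsub_right hF _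
    _ ≤ ordZero (hasseDeriv J F) := ordZero_sub_le_ordZero_hasseDeriv J F

/-- The carried indices of `init q F` have positive levels. [cite: Kawanoue2007, Lemma 2.2.1.2] -/
theorem init_levels [DecidableEq σ] [DecidableEq K] (q : ℕ) (F : MvPolynomial σ K) :
    ∀ J ∈ (init q F).idx, J.degree < q :=
  fun _ hJ => (degree_lt_of_mem_derivIndices hJ).2

/-- **Prop. 4 (2) for the FIRST blow-up of a root** (the atlas fans): for `x^q + F(y)` with `q ≤ ord₀ F`, every chart
`y_j` and every closed point `b` of the exceptional divisor, `μ̃` of the transported year-0 unit does not exceed `μ̃` at the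
root — no further hypothesis. [cite: KawanoueMatsuki2016, Proposition 4 (2)] -/
theorem muTilde_step_init_le [Fintype σ] [DecidableEq σ] [DecidableEq K] (q : ℕ) (j : σ) (b : σ → K)
    (hbj : b j = 0) {F : MvPolynomial σ K} (hF : (q : ℕ∞) ≤ ordZero F) :
    ((init q F).step q j b).muTilde q ≤ (init q F).muTilde q :=
  muTilde_step_le q j b hbj (init q F) (init_levels q F) (init_sing q hF)

end IFPState

end PointBlowup

end Literature.AlgebraicGeometry.Resolution
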